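import Literature.NumberTheory.Automorphic.JacquetLanglandsSplittingIndependence
import Literature.NumberTheory.Automorphic.ParabolicInductionAdmissibleProofs
import Literature.NumberTheory.Automorphic.GLnCuspidalSpectrumProofs
import HarnessLib

/-!
# Jacquet–Langlands: uniqueness of the local components of `πD` at a split place, and the
one-directional form of the transfer hypothesis

Topic `NumberTheory/Automorphic`; proof-only file (no definition, no named fact), continuing
`JacquetLanglandsSplittingIndependence`.

* `nonempty_equiv_of_hasLocalComponentAtD` — **uniqueness of local components on the `D` side**:
  for an automorphic `πD ≤ L²(D_𝔸ˣ ⧸ ℝ_{>0} Dˣ)` (irreducible, closed), a finite place `v` and an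
  identification `e : D_vˣ ≃* GL_n(K_v)`, two irreducible local components of `πD` at `v` through
  `e` (`HasLocalComponentAtD`; one smooth, one admissible) are isomorphic — the abstract
  Hilbert-space uniqueness theorem `nonempty_equiv_of_isTopIrreducible_of_intertwining` of
  `GLnCuspidalSpectrumFlathProofs` (Flath (1979), Thm. 3, for the printed tensor-product route)
  for the unitary irreducible `πD`, the embedding `ι_e = Quat.ofLocal ∘ e⁻¹`, the factorisation
  `D_𝔸ˣ = ι_e(GL_n(K_v)) · {c | c_v = 1}` (`Quat.ofLocal_mul_eq_mul_ofLocal_of_toCompletionUnits_eq_one`,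
  `Quat.toCompletionUnits_ofLocal_inv_mul`) and the compact open `GL_n(𝒪_v)`; the `GL_n` twin is
  `nonempty_equiv_of_hasLocalComponentAt_holds`.
* `HasLocalComponentAt.of_equiv` — `HasLocalComponentAt Π v ρ` only depends on the isomorphism
  class of `ρ` (the `GL_n` twin of `HasLocalComponentAtD.of_equiv`).
* `nonempty_equiv_of_hasLocalComponentAt_of_isSmooth`, `hasLocalComponentAtD_of_shared_localComponent`
  — the `GL_n` uniqueness with only one of the two components admissible, and: a **common**
  irreducible admissible local component of `Π` and `πD` at `v` ("`π_v ≅ π'_v`") forces every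
  irreducible smooth local component of `Π` at `v` to occur in `πD` at `v`.
* `jacquetLanglands_transfer_exists_of_localComponents_le` — consequently, in the hypothesis of
  `jacquetLanglands_transfer_exists_of_localComponents_splittings` (Gelbart (1975), Thm. 10.5 (i)
  in local-component form for one fixed system of identifications `θ₀_v`, `v ∉ Ram_f(D)`) the
  matching clause "`ρ` occurs in `Π` at `v` **iff** it occurs in `πD` at `v` through `θ₀_v`" may be
  weakened to the single implication "every irreducible smooth local component of `Π` at `v`
  occurs in `πD` at `v` through `θ₀_v`" — i.e. `Π_v ↪ π'_v`-compatibility, which is how "the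
  representation of `GL(2, 𝔸)` whose `v`-th component is equivalent to `π'_v`" (p. 148) is used: the
  converse implication follows from the existence of irreducible admissible local components of the
  cuspidal `Π` (`exists_hasLocalComponentAt_holds`, Flath) and the uniqueness on the `D` side just
  proved. What remains under `jacquetLanglands_transfer_exists` is thus: for `πD` of dimension `> 1`
  there is a cuspidal `Π` on `GL₂(𝔸_K)` whose local components at `v ∉ Ram_f(D)` occur in `πD`
  through `θ₀_v` and which at `v ∈ Ram_f(D)` has a square-integrable local component — the printed
  theorem, whose proof is the converse-theorem or trace-formula argument of Gelbart §10.
* `jacquetLanglands_transfer_exists_of_sharedLocalComponents` — the same with (i→) replaced by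
  (i≅): `Π` and `πD` have a common irreducible admissible local component at every `v ∉ Ram_f(D)`
  (through `θ₀_v`), the literal reading of "`π_v ≅ π'_v` for `v ∉ S`".
* `jacquetLanglands_transfer_surjective_of_sharedLocalComponents` — the same trimming for the
  sibling "onto" fact `jacquetLanglands_transfer_surjective` (Gelbart Thm. 10.5 (ii); JL Thm. 16.1),
  on top of `jacquetLanglands_transfer_surjective_of_localComponents` (`JacquetLanglandsLocalSatake`).

## References

* S. Gelbart, *Automorphic forms on adele groups*, Ann. of Math. Studies 83 (1975), Thm. 10.5
  (pp. 148–149) [Gelbart1975].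
* D. Flath, *Decomposition of representations into tensor products*, Proc. Sympos. Pure Math.
  33.1 (1979), Thm. 3 [FlathCorvallis1979].
* D. Bump, *Automorphic forms and representations* (1997), Thm. 3.3.3, §3.4 [Bump1997].
-/

noncomputable section

open scoped TensorProduct MatrixGroups NNReal
open NumberField IsDedekindDomain MeasureTheory
open Literature.NumberTheory.Automorphic

universe u

namespace Literature.NumberTheory.Automorphic

/-! ### `HasLocalComponentAt` is an isomorphism invariant -/

section GLEquiv

variable {n : ℕ} {K : Type} [Field K] [NumberField K]
  {μ : Measure (AdelicGroupData.gl n K).automorphicQuotient}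
  [SMulInvariantMeasure (AdelicGroupData.gl n K).Adelic (AdelicGroupData.gl n K).automorphicQuotient μ]

/-- `HasLocalComponentAt Π v ρ` only depends on the isomorphism class of `ρ`: compose the
intertwiner with `φ⁻¹` (the `GL_n` twin of `HasLocalComponentAtD.of_equiv`). Deliberate
dot-notation extension of `HasLocalComponentAt` (`GLnAdelicStructure`). [folklore] -/
theorem HasLocalComponentAt.of_equiv
    {W : ContRepresentation.ClosedSubrep ((AdelicGroupData.gl n K).rightRegular μ)}
    {v : HeightOneSpectrum (𝓞 K)} {V V' : Type*} [AddCommGroup V] [Module ℂ V]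
    [AddCommGroup V'] [Module ℂ V']
    {ρ : Representation ℂ (GL (Fin n) (v.adicCompletion K)) V}
    {ρ' : Representation ℂ (GL (Fin n) (v.adicCompletion K)) V'}
    (h : HasLocalComponentAt W v ρ) (φ : ρ.Equiv ρ') : HasLocalComponentAt W v ρ' := by
  obtain ⟨f, hf0, hf⟩ := h
  refine ⟨f ∘ₗ φ.symm.toLinearMap, fun h0 => hf0 ?_, fun g x => ?_⟩
  · refine LinearMap.ext fun x => ?_
    have h1 : (f ∘ₗ φ.symm.toLinearMap) (φ x) = 0 := by rw [h0, LinearMap.zero_apply]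
    change f (φ.symm (φ x)) = 0 at h1
    rw [φ.symm_apply_apply] at h1
    exact h1
  · change f (φ.symm (ρ' g x)) = W.toContRep (GLn.ofLocal n K v g) (f (φ.symm x))
    have := Representation.IntertwiningMap.isIntertwining ρ' ρ φ.symm.toIntertwiningMap g x
    change φ.symm (ρ' g x) = ρ g (φ.symm x) at this
    rw [this, hf]

end GLEquiv

/-! ### Uniqueness of local components on the `D` side -/

section UniqueD

variable {K : Type} [Field K] [NumberField K] {D : Type u} [Ring D] [Algebra K D]
  [Module.Finite K D]
  {μ_D : Measure (AdelicGroupData.units K D).automorphicQuotient}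
  [(AdelicGroupData.units K D).IsAutomorphicMeasure μ_D]
  {n : ℕ} {v : HeightOneSpectrum (𝓞 K)}

/-- **Uniqueness of local components of an automorphic representation of `D^×` (Flath).** Let
`πD ≤ L²(D_𝔸ˣ ⧸ ℝ_{>0} Dˣ)` be irreducible and closed, `v` a finite place and
`e : D_vˣ ≃* GL_n(K_v)` an identification. Two irreducible local components `ρ` (smooth) and
`ρ'` (admissible) of `πD` at `v` through `e` (`HasLocalComponentAtD`) are isomorphic:
`nonempty_equiv_of_isTopIrreducible_of_intertwining` for the unitary irreducible `πD`
(`ClosedSubrep.isUnitary_toContRep`), `ι = Quat.ofLocal ∘ e⁻¹`,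
`D_𝔸ˣ = ι(GL_n(K_v)) · {c | c_v = 1}` with `{c | c_v = 1}` centralising `ι(GL_n(K_v))`
(`Quat.toCompletionUnits_ofLocal_inv_mul`,
`Quat.ofLocal_mul_eq_mul_ofLocal_of_toCompletionUnits_eq_one`) and the compact open `GL_n(𝒪_v)`
(Flath, Corvallis (1979), Thm. 3; Bump (1997), Thm. 3.3.3; the `GL_n` statement is
`nonempty_equiv_of_hasLocalComponentAt_holds`). [cite: FlathCorvallis1979, Thm. 3] -/
theorem nonempty_equiv_of_hasLocalComponentAtD
    (πD : DiscreteAutomorphicRep (AdelicGroupData.units K D) μ_D)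
    (e : completionUnits D v ≃* GL (Fin n) (v.adicCompletion K))
    {V V' : Type*} [AddCommGroup V] [Module ℂ V] [AddCommGroup V'] [Module ℂ V']
    {ρ : Representation ℂ (GL (Fin n) (v.adicCompletion K)) V}
    {ρ' : Representation ℂ (GL (Fin n) (v.adicCompletion K)) V'}
    (hρ : ρ.IsIrreducible) (hρs : ρ.IsSmooth) (h : HasLocalComponentAtD e πD.space ρ)
    (hρ' : ρ'.IsIrreducible) (hρ'a : ρ'.IsAdmissible) (h' : HasLocalComponentAtD e πD.space ρ') :
    Nonempty (ρ.Equiv ρ') := by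
  obtain ⟨f, hf0, hf⟩ := h
  obtain ⟨f', hf'0, hf'⟩ := h'
  let ι : GL (Fin n) (v.adicCompletion K) →* (AdelicGroupData.units K D).Adelic :=
    (Quat.ofLocal K D v).comp e.symm.toMonoidHom
  have hU : πD.space.toContRep.IsUnitary :=
    ClosedSubrep.isUnitary_toContRep ((AdelicGroupData.units K D).isUnitary_rightRegular μ_D)
      πD.space
  have hgen : ∀ x : (AdelicGroupData.units K D).Adelic,
      ∃ (l : GL (Fin n) (v.adicCompletion K)) (c : (AdelicGroupData.units K D).Adelic),
        c ∈ Subgroup.centralizer (Set.range ι) ∧ x = ι l * c := by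
    intro x
    have hιx : ι (e (toCompletionUnits K D v x)) =
        Quat.ofLocal K D v (toCompletionUnits K D v x) := by
      change Quat.ofLocal K D v (e.symm (e (toCompletionUnits K D v x))) = _
      rw [MulEquiv.symm_apply_apply]
    refine ⟨e (toCompletionUnits K D v x), (ι (e (toCompletionUnits K D v x)))⁻¹ * x, ?_,
      (mul_inv_cancel_left _ _).symm⟩
    have hc : toCompletionUnits K D v ((ι (e (toCompletionUnits K D v x)))⁻¹ * x) = 1 := by
      rw [hιx]
      exact Quat.toCompletionUnits_ofLocal_inv_mul x
    rw [Subgroup.mem_centralizer_iff]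
    rintro _ ⟨t, rfl⟩
    exact Quat.ofLocal_mul_eq_mul_ofLocal_of_toCompletionUnits_eq_one (e.symm t) hc
  exact nonempty_equiv_of_isTopIrreducible_of_intertwining hU πD.irreducible ι hgen
    ⟨_, isOpen_valuedCongruenceSubgroup_one n K v, isCompact_valuedCongruenceSubgroup_one n K v⟩
    hρ hρs hf0 hf hρ' hρ'a hf'0 hf'

/-- **A local component of `πD` occurring in a cuspidal `Π` forces the converse matching.** If
every irreducible smooth local component of the cuspidal `Π` of `GL_n(𝔸_K)` at `v` occurs in `πD`
at `v` through `e`, then conversely every irreducible smooth local component of `πD` at `v`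
through `e` occurs in `Π` at `v`: `Π` has an irreducible admissible local component `ρ₀` at `v`
(`exists_hasLocalComponentAt_holds`, Flath; moved to the universe of the hypothesis by `ULift`),
which occurs in `πD` by hypothesis, so `ρ ≅ ρ₀` by the uniqueness on the `D` side
(`nonempty_equiv_of_hasLocalComponentAtD`), and `HasLocalComponentAt` is an isomorphism
invariant. [folklore] -/
theorem hasLocalComponentAt_of_hasLocalComponentAtD_of_forall
    {μ : Measure (AdelicGroupData.gl n K).automorphicQuotient}
    [(AdelicGroupData.gl n K).IsAutomorphicMeasure μ]
    (P : CuspidalAutomorphicRepGL n K μ)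
    (πD : DiscreteAutomorphicRep (AdelicGroupData.units K D) μ_D)
    (e : completionUnits D v ≃* GL (Fin n) (v.adicCompletion K))
    (h : ∀ (V : Type u) [AddCommGroup V] [Module ℂ V]
      (ρ : Representation ℂ (GL (Fin n) (v.adicCompletion K)) V),
      ρ.IsIrreducible → ρ.IsSmooth → HasLocalComponentAt P.1 v ρ → HasLocalComponentAtD e πD.space ρ)
    {V : Type*} [AddCommGroup V] [Module ℂ V]
    {ρ : Representation ℂ (GL (Fin n) (v.adicCompletion K)) V}
    (hρ : ρ.IsIrreducible) (hρs : ρ.IsSmooth) (hD : HasLocalComponentAtD e πD.space ρ) :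
    HasLocalComponentAt P.1 v ρ := by
  obtain ⟨V₀, _, _, ρ₀, hρ₀i, hρ₀a, hρ₀l⟩ := exists_hasLocalComponentAt_holds P v
  obtain ⟨ρ₁, ⟨e₁⟩⟩ : ∃ ρ₁ : Representation ℂ (GL (Fin n) (v.adicCompletion K)) (ULift.{u} V₀),
      Nonempty (ρ₀.Equiv ρ₁) := Representation.exists_equiv_ulift ρ₀
  haveI := hρ₀i
  have hρ₁i : ρ₁.IsIrreducible :=
    Literature.RepresentationTheory.Semisimple.Representation.isIrreducible_of_equiv e₁
  have hρ₁a : ρ₁.IsAdmissible := hρ₀a.of_equiv e₁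
  have hρ₁l : HasLocalComponentAt P.1 v ρ₁ := hρ₀l.of_equiv e₁
  have hρ₁D : HasLocalComponentAtD e πD.space ρ₁ := h (ULift.{u} V₀) ρ₁ hρ₁i hρ₁a.1 hρ₁l
  obtain ⟨e₂⟩ := nonempty_equiv_of_hasLocalComponentAtD πD e hρ hρs hD hρ₁i hρ₁a hρ₁D
  exact hρ₁l.of_equiv e₂.symm

/-- **Uniqueness of local components of a cuspidal `Π` of `GL_n(𝔸_K)`, smooth/admissible form**:
an irreducible *smooth* local component `ρ` and an irreducible admissible local component `ρ'` of
`Π` at `v` are isomorphic (the tree's `nonempty_equiv_of_hasLocalComponentAt_holds` asks for both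
to be admissible; the abstract `nonempty_equiv_of_isTopIrreducible_of_intertwining` only uses the
smoothness of `ρ`, and the `GL_n` inputs are the same: `GLn.toLocal_ofLocal`,
`GLn.ofLocal_mul_eq_mul_ofLocal_of_toLocal_eq_one`, the compact open `GL_n(𝒪_v)`)
(Flath, Corvallis (1979), Thm. 3; Bump (1997), Thm. 3.3.3). [cite: FlathCorvallis1979, Thm. 3] -/
theorem nonempty_equiv_of_hasLocalComponentAt_of_isSmooth
    {μ : Measure (AdelicGroupData.gl n K).automorphicQuotient}
    [(AdelicGroupData.gl n K).IsAutomorphicMeasure μ]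
    (P : CuspidalAutomorphicRepGL n K μ)
    {V V' : Type*} [AddCommGroup V] [Module ℂ V] [AddCommGroup V'] [Module ℂ V']
    {ρ : Representation ℂ (GL (Fin n) (v.adicCompletion K)) V}
    {ρ' : Representation ℂ (GL (Fin n) (v.adicCompletion K)) V'}
    (hρ : ρ.IsIrreducible) (hρs : ρ.IsSmooth) (h : HasLocalComponentAt P.1 v ρ)
    (hρ' : ρ'.IsIrreducible) (hρ'a : ρ'.IsAdmissible) (h' : HasLocalComponentAt P.1 v ρ') :
    Nonempty (ρ.Equiv ρ') := by
  obtain ⟨f, hf0, hf⟩ := h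
  obtain ⟨f', hf'0, hf'⟩ := h'
  have hU : P.1.toContRep.IsUnitary :=
    ClosedSubrep.isUnitary_toContRep ((AdelicGroupData.gl n K).isUnitary_rightRegular μ) P.1
  have hgen : ∀ x : GL (Fin n) (AdeleRing (𝓞 K) K),
      ∃ (l : GL (Fin n) (v.adicCompletion K)) (c : GL (Fin n) (AdeleRing (𝓞 K) K)),
        c ∈ Subgroup.centralizer (Set.range (GLn.ofLocal n K v)) ∧ x = GLn.ofLocal n K v l * c := by
    have hπι : ∀ y : GL (Fin n) (v.adicCompletion K),
        Matrix.GeneralLinearGroup.map (AdelicGroupData.adeleEval K v) (GLn.ofLocal n K v y) = y :=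
      fun y => GLn.toLocal_ofLocal y
    intro x
    refine ⟨Matrix.GeneralLinearGroup.map (AdelicGroupData.adeleEval K v) x,
      (GLn.ofLocal n K v (Matrix.GeneralLinearGroup.map (AdelicGroupData.adeleEval K v) x))⁻¹ * x,
      ?_, (mul_inv_cancel_left _ _).symm⟩
    rw [Subgroup.mem_centralizer_iff]
    rintro _ ⟨t, rfl⟩
    refine GLn.ofLocal_mul_eq_mul_ofLocal_of_toLocal_eq_one t ?_
    rw [map_mul, map_inv, hπι, inv_mul_cancel]
  exact nonempty_equiv_of_isTopIrreducible_of_intertwining hU P.2.2 (GLn.ofLocal n K v) hgen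
    ⟨_, isOpen_valuedCongruenceSubgroup_one n K v, isCompact_valuedCongruenceSubgroup_one n K v⟩
    hρ hρs hf0 hf hρ' hρ'a hf'0 hf'

/-- **A shared local component forces the one-directional matching.** If the cuspidal `Π` of
`GL_n(𝔸_K)` and the automorphic `πD` of `D_𝔸ˣ` have a common irreducible admissible local
component `ρ₀` at `v` (through `e` on the `D` side) — "`π_v ≅ π'_v`" — then every irreducible
smooth local component `ρ` of `Π` at `v` occurs in `πD` at `v` through `e`: `ρ ≅ ρ₀` by the
uniqueness of local components of `Π` (`nonempty_equiv_of_hasLocalComponentAt_of_isSmooth`), and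
`HasLocalComponentAtD` is an isomorphism invariant (`HasLocalComponentAtD.of_equiv`). [folklore] -/
theorem hasLocalComponentAtD_of_shared_localComponent
    {μ : Measure (AdelicGroupData.gl n K).automorphicQuotient}
    [(AdelicGroupData.gl n K).IsAutomorphicMeasure μ]
    (P : CuspidalAutomorphicRepGL n K μ)
    (πD : DiscreteAutomorphicRep (AdelicGroupData.units K D) μ_D)
    (e : completionUnits D v ≃* GL (Fin n) (v.adicCompletion K))
    {V₀ : Type*} [AddCommGroup V₀] [Module ℂ V₀]
    {ρ₀ : Representation ℂ (GL (Fin n) (v.adicCompletion K)) V₀}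
    (hρ₀ : ρ₀.IsIrreducible) (hρ₀a : ρ₀.IsAdmissible) (h₀ : HasLocalComponentAt P.1 v ρ₀)
    (h₀D : HasLocalComponentAtD e πD.space ρ₀)
    {V : Type*} [AddCommGroup V] [Module ℂ V]
    {ρ : Representation ℂ (GL (Fin n) (v.adicCompletion K)) V}
    (hρ : ρ.IsIrreducible) (hρs : ρ.IsSmooth) (h : HasLocalComponentAt P.1 v ρ) :
    HasLocalComponentAtD e πD.space ρ := by
  obtain ⟨φ⟩ := nonempty_equiv_of_hasLocalComponentAt_of_isSmooth P hρ hρs h hρ₀ hρ₀a h₀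
  exact HasLocalComponentAtD.of_equiv φ.symm h₀D

end UniqueD

/-! ### Consequence for the existence of the transfer -/

section Assembly

variable (K : Type) [Field K] [NumberField K] (D : Type u) [Ring D] [Algebra K D]
  [IsQuaternionAlgebra K D]

/-- **`jacquetLanglands_transfer_exists` from the one-directional local-component form of
Gelbart's Theorem 10.5 (i).** Fix splittings `θ₀_v : D_v ≃ₐ[K_v] M₂(K_v)` at the places
`v ∉ Ram_f(D)`. Suppose (`hA₁`): for `D` a division quaternion algebra and every automorphic
`πD ≤ L²(D_𝔸ˣ ⧸ ℝ_{>0} Dˣ)` of dimension `> 1` there is a cuspidal `Π` of `GL₂(𝔸_K)` such that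
(i→) at every `v ∉ Ram_f(D)` every irreducible smooth local component of `Π` at `v` occurs in `πD`
at `v` through `θ₀_v` ("the representation of `GL(2, 𝔸)` whose `v`-th component is equivalent to
`π'_v` if `v ∉ S` … is a cusp form", Gelbart (1975), Thm. 10.5 (i), p. 148) and (ii) at every
`v ∈ Ram_f(D)` `Π` has an irreducible admissible local component which is square-integrable
modulo the centre ("such that `π_v` is square-integrable for each `v ∈ S`", p. 149; Thm. 7.6 (ii),
p. 92). Then `jacquetLanglands_transfer_exists K D`: the converse matching (i←) is
`hasLocalComponentAt_of_hasLocalComponentAtD_of_forall` (existence of local components of `Π`,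
uniqueness of those of `πD`), and (i↔) with (ii) is the hypothesis of
`jacquetLanglands_transfer_exists_of_localComponents_splittings`.
[cite: Gelbart1975, Thm. 10.5 (i)–(ii), pp. 148–149] -/
theorem jacquetLanglands_transfer_exists_of_localComponents_le
    (θ₀ : ∀ v, v ∉ ramifiedPlaces K D →
      (ScalarExtension K (v.adicCompletion K) D ≃ₐ[v.adicCompletion K]
        Matrix (Fin 2) (Fin 2) (v.adicCompletion K)))
    (hA₁ : ∀ (_hdiv : ∀ x : D, x ≠ 0 → IsUnit x)
      (μ_D : Measure (AdelicGroupData.units K D).automorphicQuotient)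
      [(AdelicGroupData.units K D).IsAutomorphicMeasure μ_D]
      (μ : Measure (AdelicGroupData.gl 2 K).automorphicQuotient)
      [(AdelicGroupData.gl 2 K).IsAutomorphicMeasure μ]
      [∀ v : HeightOneSpectrum (𝓞 K), MeasurableSpace (GL (Fin 2) (v.adicCompletion K) ⧸
        Subgroup.center (GL (Fin 2) (v.adicCompletion K)))]
      [∀ v : HeightOneSpectrum (𝓞 K), BorelSpace (GL (Fin 2) (v.adicCompletion K) ⧸
        Subgroup.center (GL (Fin 2) (v.adicCompletion K)))]
      (πD : DiscreteAutomorphicRep (AdelicGroupData.units K D) μ_D), ¬ πD.IsOneDimensional →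
      ∃ π : CuspidalAutomorphicRepGL 2 K μ,
        (∀ (v : HeightOneSpectrum (𝓞 K)) (hv : v ∉ ramifiedPlaces K D)
            (V : Type u) [AddCommGroup V] [Module ℂ V]
            (ρ : Representation ℂ (GL (Fin 2) (v.adicCompletion K)) V),
            ρ.IsIrreducible → ρ.IsSmooth → HasLocalComponentAt π.1 v ρ →
              HasLocalComponentAtD (unitsEquivOfSplitting (θ₀ v hv)) πD.space ρ) ∧
        (∀ v ∈ ramifiedPlaces K D, ∃ (V : Type) (_ : AddCommGroup V) (_ : Module ℂ V)
            (ρ : Representation ℂ (GL (Fin 2) (v.adicCompletion K)) V),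
            ρ.IsIrreducible ∧ ρ.IsAdmissible ∧ HasLocalComponentAt π.1 v ρ ∧
              ∀ (ν : Measure (GL (Fin 2) (v.adicCompletion K) ⧸
                Subgroup.center (GL (Fin 2) (v.adicCompletion K)))) [ν.IsHaarMeasure],
                ρ.IsSquareIntegrableModCenter ν)) :
    jacquetLanglands_transfer_exists K D := by
  refine jacquetLanglands_transfer_exists_of_localComponents_splittings K D θ₀
    fun hdiv μ_D _ μ _ _ _ πD hπD => ?_
  obtain ⟨π, hle, hsq⟩ := hA₁ hdiv μ_D μ πD hπD
  refine ⟨π, fun v hv V _ _ ρ hi hs => ⟨hle v hv V ρ hi hs, fun hD => ?_⟩, hsq⟩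
  exact hasLocalComponentAt_of_hasLocalComponentAtD_of_forall π πD
    (unitsEquivOfSplitting (θ₀ v hv)) (hle v hv) hi hs hD


/-- **`jacquetLanglands_transfer_exists` from Gelbart's Theorem 10.5 (i) as printed: a cuspidal
`Π` with `Π_v ≅ π'_v` for `v ∉ Ram_f(D)` and `Π_v` square-integrable for `v ∈ Ram_f(D)`.** Fix
splittings `θ₀_v : D_v ≃ₐ[K_v] M₂(K_v)` at the places `v ∉ Ram_f(D)`. Suppose (`hA₂`): for `D` a
division quaternion algebra and every automorphic `πD ≤ L²(D_𝔸ˣ ⧸ ℝ_{>0} Dˣ)` of dimension `> 1`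
there is a cuspidal `Π` of `GL₂(𝔸_K)` such that (i≅) at every `v ∉ Ram_f(D)` the representations
`Π` and `πD` have a **common** irreducible admissible local component at `v` (through `θ₀_v`) —
"`π = ⊗ π_v`, `π_v ≅ π'_v` for `v ∉ S` … is a cusp form for `G_𝔸`" (Gelbart (1975), Thm. 10.5 (i),
p. 148) — and (ii) at every `v ∈ Ram_f(D)` `Π` has an irreducible admissible local component
which is square-integrable modulo the centre ("`π_v` is square-integrable for each `v ∈ S`",
p. 149; Thm. 7.6 (ii), p. 92). Then `jacquetLanglands_transfer_exists K D`: a common local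
component gives the one-directional matching (`hasLocalComponentAtD_of_shared_localComponent`,
uniqueness of the local components of `Π`), which is the hypothesis of
`jacquetLanglands_transfer_exists_of_localComponents_le`. This is the printed statement read in
the tree's vocabulary; what it leaves to prove is the theorem itself (converse theorem or trace
formula, Gelbart §10). [cite: Gelbart1975, Thm. 10.5 (i)–(ii), pp. 148–149] -/
theorem jacquetLanglands_transfer_exists_of_sharedLocalComponents
    (θ₀ : ∀ v, v ∉ ramifiedPlaces K D →
      (ScalarExtension K (v.adicCompletion K) D ≃ₐ[v.adicCompletion K]
        Matrix (Fin 2) (Fin 2) (v.adicCompletion K)))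
    (hA₂ : ∀ (_hdiv : ∀ x : D, x ≠ 0 → IsUnit x)
      (μ_D : Measure (AdelicGroupData.units K D).automorphicQuotient)
      [(AdelicGroupData.units K D).IsAutomorphicMeasure μ_D]
      (μ : Measure (AdelicGroupData.gl 2 K).automorphicQuotient)
      [(AdelicGroupData.gl 2 K).IsAutomorphicMeasure μ]
      [∀ v : HeightOneSpectrum (𝓞 K), MeasurableSpace (GL (Fin 2) (v.adicCompletion K) ⧸
        Subgroup.center (GL (Fin 2) (v.adicCompletion K)))]
      [∀ v : HeightOneSpectrum (𝓞 K), BorelSpace (GL (Fin 2) (v.adicCompletion K) ⧸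
        Subgroup.center (GL (Fin 2) (v.adicCompletion K)))]
      (πD : DiscreteAutomorphicRep (AdelicGroupData.units K D) μ_D), ¬ πD.IsOneDimensional →
      ∃ π : CuspidalAutomorphicRepGL 2 K μ,
        (∀ (v : HeightOneSpectrum (𝓞 K)) (hv : v ∉ ramifiedPlaces K D),
            ∃ (V : Type) (_ : AddCommGroup V) (_ : Module ℂ V)
              (ρ : Representation ℂ (GL (Fin 2) (v.adicCompletion K)) V),
              ρ.IsIrreducible ∧ ρ.IsAdmissible ∧ HasLocalComponentAt π.1 v ρ ∧
                HasLocalComponentAtD (unitsEquivOfSplitting (θ₀ v hv)) πD.space ρ) ∧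
        (∀ v ∈ ramifiedPlaces K D, ∃ (V : Type) (_ : AddCommGroup V) (_ : Module ℂ V)
            (ρ : Representation ℂ (GL (Fin 2) (v.adicCompletion K)) V),
            ρ.IsIrreducible ∧ ρ.IsAdmissible ∧ HasLocalComponentAt π.1 v ρ ∧
              ∀ (ν : Measure (GL (Fin 2) (v.adicCompletion K) ⧸
                Subgroup.center (GL (Fin 2) (v.adicCompletion K)))) [ν.IsHaarMeasure],
                ρ.IsSquareIntegrableModCenter ν)) :
    jacquetLanglands_transfer_exists K D := by
  refine jacquetLanglands_transfer_exists_of_localComponents_le K D θ₀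
    fun hdiv μ_D _ μ _ _ _ πD hπD => ?_
  obtain ⟨π, hsh, hsq⟩ := hA₂ hdiv μ_D μ πD hπD
  refine ⟨π, fun v hv V _ _ ρ hi hs hl => ?_, hsq⟩
  obtain ⟨V₀, _, _, ρ₀, hρ₀i, hρ₀a, hρ₀l, hρ₀D⟩ := hsh v hv
  exact hasLocalComponentAtD_of_shared_localComponent π πD (unitsEquivOfSplitting (θ₀ v hv))
    hρ₀i hρ₀a hρ₀l hρ₀D hi hs hl


/-- **The "onto" half, same reading.** The sibling reduction
`jacquetLanglands_transfer_surjective_of_localComponents` (`JacquetLanglandsLocalSatake`) of the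
named fact `jacquetLanglands_transfer_surjective` (Gelbart (1975), Thm. 10.5 (ii) "onto";
Jacquet–Langlands, LNM 114, Thm. 16.1) asks, for the automorphic `πD` attached to a cuspidal `Π`,
for the matching "`ρ` occurs in `Π` at `v` iff it occurs in `πD` at `v` through `θ`" for every
split `v` and **every** splitting `θ`. By the uniqueness of local components on both sides
(`hasLocalComponentAtD_of_shared_localComponent`,
`hasLocalComponentAt_of_hasLocalComponentAtD_of_forall`) and the independence of the splitting
(`hasLocalComponentAtD_unitsEquivOfSplitting_iff`, Skolem–Noether) it suffices that `Π` and `πD`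
have a **common** irreducible admissible local component at every `v ∉ Ram_f(D)` through one
fixed `θ₀_v` — "`π'_v ≅ π_v` for `v ∉ S`" as printed (Gelbart, Thm. 10.5 (ii), p. 149).
[cite: Gelbart1975, Thm. 10.5 (ii), p. 149] -/
theorem jacquetLanglands_transfer_surjective_of_sharedLocalComponents
    (θ₀ : ∀ v, v ∉ ramifiedPlaces K D →
      (ScalarExtension K (v.adicCompletion K) D ≃ₐ[v.adicCompletion K]
        Matrix (Fin 2) (Fin 2) (v.adicCompletion K)))
    (hS₂ : ∀ (_hdiv : ∀ x : D, x ≠ 0 → IsUnit x)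
      (μ_D : Measure (AdelicGroupData.units K D).automorphicQuotient)
      [(AdelicGroupData.units K D).IsAutomorphicMeasure μ_D]
      (μ : Measure (AdelicGroupData.gl 2 K).automorphicQuotient)
      [(AdelicGroupData.gl 2 K).IsAutomorphicMeasure μ]
      [∀ v : HeightOneSpectrum (𝓞 K), MeasurableSpace (GL (Fin 2) (v.adicCompletion K) ⧸
        Subgroup.center (GL (Fin 2) (v.adicCompletion K)))]
      [∀ v : HeightOneSpectrum (𝓞 K), BorelSpace (GL (Fin 2) (v.adicCompletion K) ⧸
        Subgroup.center (GL (Fin 2) (v.adicCompletion K)))]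
      (ν : ∀ v : HeightOneSpectrum (𝓞 K), Measure (GL (Fin 2) (v.adicCompletion K) ⧸
        Subgroup.center (GL (Fin 2) (v.adicCompletion K))))
      [∀ v, (ν v).IsHaarMeasure],
      ramifiedInfinitePlaces K D = ∅ →
      ∀ π : CuspidalAutomorphicRepGL 2 K μ,
        (∀ v ∈ ramifiedPlaces K D, ∃ (V : Type) (_ : AddCommGroup V) (_ : Module ℂ V)
            (ρ : Representation ℂ (GL (Fin 2) (v.adicCompletion K)) V),
            ρ.IsIrreducible ∧ ρ.IsAdmissible ∧ HasLocalComponentAt π.1 v ρ ∧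
              ρ.IsEssentiallyDiscreteSeries (ν v)) →
        ∃ πD : DiscreteAutomorphicRep (AdelicGroupData.units K D) μ_D,
          ¬ πD.IsOneDimensional ∧
          ∀ (v : HeightOneSpectrum (𝓞 K)) (hv : v ∉ ramifiedPlaces K D),
            ∃ (V : Type) (_ : AddCommGroup V) (_ : Module ℂ V)
              (ρ : Representation ℂ (GL (Fin 2) (v.adicCompletion K)) V),
              ρ.IsIrreducible ∧ ρ.IsAdmissible ∧ HasLocalComponentAt π.1 v ρ ∧
                HasLocalComponentAtD (unitsEquivOfSplitting (θ₀ v hv)) πD.space ρ) :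
    jacquetLanglands_transfer_surjective K D := by
  refine jacquetLanglands_transfer_surjective_of_localComponents K D
    fun hdiv μ_D _ μ _ _ _ ν _ hinf π hπ => ?_
  obtain ⟨πD, h1, hsh⟩ := hS₂ hdiv μ_D μ ν hinf π hπ
  refine ⟨πD, h1, fun v θ V _ _ ρ hi hs => ?_⟩
  have hv : v ∉ ramifiedPlaces K D := fun hr => hr ⟨θ⟩
  obtain ⟨V₀, _, _, ρ₀, hρ₀i, hρ₀a, hρ₀l, hρ₀D⟩ := hsh v hv
  have hfwd : ∀ (W : Type u) [AddCommGroup W] [Module ℂ W]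
      (σ : Representation ℂ (GL (Fin 2) (v.adicCompletion K)) W),
      σ.IsIrreducible → σ.IsSmooth → HasLocalComponentAt π.1 v σ →
        HasLocalComponentAtD (unitsEquivOfSplitting (θ₀ v hv)) πD.space σ :=
    fun W _ _ σ hσi hσs hσl => hasLocalComponentAtD_of_shared_localComponent π πD
      (unitsEquivOfSplitting (θ₀ v hv)) hρ₀i hρ₀a hρ₀l hρ₀D hσi hσs hσl
  rw [← hasLocalComponentAtD_unitsEquivOfSplitting_iff (θ₀ v hv) θ πD.space ρ]
  exact ⟨hfwd V ρ hi hs, fun hD => hasLocalComponentAt_of_hasLocalComponentAtD_of_forall π πD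
    (unitsEquivOfSplitting (θ₀ v hv)) hfwd hi hs hD⟩

end Assembly

end Literature.NumberTheory.Automorphic
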